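import Literature.MathematicalPhysics.QuantumLattice.PairCorrelations
import HarnessLib

/-!
# Pair correlations: the `D₄` point-group action on the torus (proofs)

Trunk T-QLATTICE, family `hubbard` (companion of
`Literature.MathematicalPhysics.QuantumLattice.PairCorrelations`, which states the notions and the
named facts; this file only PROVES — it declares no definition).

## Contents

* the elementary relations of the square-lattice point group realised on torus sites
  `(ℤ/Lℤ)²` by `rotSite` (`(a, b) ↦ (-b, a)`) and `reflSite` (`(a, b) ↦ (a, -b)`):
  `refl² = 1` (`reflSite_reflSite`), `rot⁴ = 1` (`rotSite_iterate_four`, hence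
  `rotSite_iterate_mod_four`, `rotSite_iterate_eq_of_mod_eq`) and
  `rot ∘ refl = refl ∘ rot³` (`rotSite_reflSite`, iterated: `rotSite_iterate_reflSite`);
* the discharge **`d4Site_mul_holds`** of the named fact `d4Site_mul`: `d4Site` is a left action
  of Mathlib's `DihedralGroup 4` (multiplication table `r i * r j = r (i + j)`,
  `r i * sr j = sr (j - i)`, `sr i * r j = sr (i + j)`, `sr i * sr j = r (j - i)`); the four
  cases reduce, by the relations above, to congruences modulo `4` between `ZMod 4` values, which
  are decided;
* the discharge **`d4Orb_mul_holds`** of the named fact `d4Orb_mul` (the induced action on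
  orbitals `(site, spin)` of the fermionic torus), from `d4Site_mul_holds` and
  `toTorusSite ∘ ofTorusSite = id`; with it the in-file user `d4Act_mul (hOrb : d4Orb_mul)` can
  be fed `d4Orb_mul_holds`.

## Sources

D. J. Scalapino, *The case for d_{x²-y²} pairing in the cuprate superconductors*, Phys. Rep. 250
(1995) 329, §2 (the point group `C₄ᵥ ≅ D₄` of the square lattice and its `B₁g` representation;
the source fixes the group, the action law itself is elementary group theory — the dihedral
presentation `⟨r, s | r⁴ = s² = 1, s r s = r⁻¹⟩`).

## Design notes

* No definition is introduced. The lemmas are stated for every side `L : ℕ` (no `NeZero L`),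
  exactly as `d4Site_mul` quantifies.
* `rotSite^[n]` is kept as a function iterate (as in `d4Site`); periodicity is expressed through
  `n % 4` so that the `ZMod 4` bookkeeping is a closed decidable statement (`decide`).
-/

noncomputable section

namespace Literature.MathematicalPhysics.QuantumLattice

open Literature.Probability.LatticeModels DihedralGroup

/-- Two reflections in the `x`-axis cancel: `refl (refl x) = x` (`s² = 1` in `D₄`).
Scalapino, Phys. Rep. 250 (1995) 329, §2 (square-lattice point group). [folklore] -/
@[simp] theorem reflSite_reflSite {L : ℕ} (x : TorusSite 2 L) : reflSite (reflSite x) = x := by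
  ext k
  fin_cases k <;> simp [reflSite]

/-- Four rotations by `π/2` are the identity: `rot⁴ = 1` (`r⁴ = 1` in `D₄`).
Scalapino, Phys. Rep. 250 (1995) 329, §2 (square-lattice point group). [folklore] -/
@[simp] theorem rotSite_iterate_four {L : ℕ} (x : TorusSite 2 L) : rotSite^[4] x = x := by
  ext k
  fin_cases k <;> simp [rotSite]

/-- `rotⁿ x` only depends on `n mod 4`.
Scalapino, Phys. Rep. 250 (1995) 329, §2 (square-lattice point group). [folklore] -/
theorem rotSite_iterate_mod_four {L : ℕ} (n : ℕ) (x : TorusSite 2 L) :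
    rotSite^[n % 4] x = rotSite^[n] x := by
  conv_rhs => rw [← Nat.mod_add_div n 4, Function.iterate_add_apply, Function.iterate_mul]
  rw [Function.iterate_fixed (rotSite_iterate_four x)]

/-- `rotᵃ x = rotᵇ x` whenever `a ≡ b (mod 4)`.
Scalapino, Phys. Rep. 250 (1995) 329, §2 (square-lattice point group). [folklore] -/
theorem rotSite_iterate_eq_of_mod_eq {L : ℕ} {a b : ℕ} (h : a % 4 = b % 4) (x : TorusSite 2 L) :
    rotSite^[a] x = rotSite^[b] x := by
  rw [← rotSite_iterate_mod_four a, h, rotSite_iterate_mod_four]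

/-- The dihedral relation `rot ∘ refl = refl ∘ rot⁻¹ = refl ∘ rot³` (`r s = s r⁻¹` in `D₄`).
Scalapino, Phys. Rep. 250 (1995) 329, §2 (square-lattice point group). [folklore] -/
theorem rotSite_reflSite {L : ℕ} (x : TorusSite 2 L) :
    rotSite (reflSite x) = reflSite (rotSite^[3] x) := by
  ext k
  fin_cases k <;> simp [rotSite, reflSite]

/-- Iterated dihedral relation `rotⁿ ∘ refl = refl ∘ rot³ⁿ`.
Scalapino, Phys. Rep. 250 (1995) 329, §2 (square-lattice point group). [folklore] -/
theorem rotSite_iterate_reflSite {L : ℕ} (n : ℕ) (x : TorusSite 2 L) :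
    rotSite^[n] (reflSite x) = reflSite (rotSite^[3 * n] x) := by
  induction n with
  | zero => rfl
  | succ n ih =>
    rw [Function.iterate_succ_apply', ih, rotSite_reflSite, ← Function.iterate_add_apply]
    congr 2
    ring

/-- **Discharge of `d4Site_mul`**: `d4Site` is a left action of `D₄` on the torus `(ℤ/Lℤ)²`
for Mathlib's multiplication table of `DihedralGroup 4` (`r i * r j = r (i + j)`,
`r i * sr j = sr (j - i)`, `sr i * r j = sr (i + j)`, `sr i * sr j = r (j - i)`), by the
relations `rot⁴ = 1`, `refl² = 1`, `rot ∘ refl = refl ∘ rot³` and arithmetic in `ZMod 4`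
(`(i + j).val ≡ i.val + j.val`, `(j - i).val ≡ 3 i.val + j.val (mod 4)`, decided).
The cited source fixes the point group `C₄ᵥ ≅ D₄` of the square lattice; the action law itself is
elementary group theory. Scalapino, Phys. Rep. 250 (1995) 329, §2. [cite: Scalapino1995, §2] -/
theorem d4Site_mul_holds : d4Site_mul := by
  intro L γ₁ γ₂ x
  rcases γ₁ with i | i <;> rcases γ₂ with j | j
  · simp only [r_mul_r, d4Site]
    rw [← Function.iterate_add_apply]
    apply rotSite_iterate_eq_of_mod_eq
    revert i j
    decide
  · simp only [r_mul_sr, d4Site]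
    rw [rotSite_iterate_reflSite, ← Function.iterate_add_apply]
    congr 1
    apply rotSite_iterate_eq_of_mod_eq
    revert i j
    decide
  · simp only [sr_mul_r, d4Site]
    rw [← Function.iterate_add_apply]
    congr 1
    apply rotSite_iterate_eq_of_mod_eq
    revert i j
    decide
  · simp only [sr_mul_sr, d4Site]
    rw [rotSite_iterate_reflSite, reflSite_reflSite, ← Function.iterate_add_apply]
    apply rotSite_iterate_eq_of_mod_eq
    revert i j
    decide

/-- **Discharge of `d4Orb_mul`**: the induced action on Hubbard orbitals of the fermionic torus
(sites moved by `d4Site`, spin fixed) is a left action of `D₄`, from `d4Site_mul_holds` and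
`toTorusSite ∘ ofTorusSite = id` (`FermionTorus.toTorusSite_ofTorusSite`).
Scalapino, Phys. Rep. 250 (1995) 329, §2. [cite: Scalapino1995, §2] -/
theorem d4Orb_mul_holds : d4Orb_mul := by
  intro L _ γ₁ γ₂ o
  have h : ∀ x : TorusSite 2 L, d4Site (γ₁ * γ₂) x = d4Site γ₁ (d4Site γ₂ x) :=
    fun x => d4Site_mul_holds γ₁ γ₂ x
  simp only [d4Orb, ofLex_toLex, FermionTorus.toTorusSite_ofTorusSite, h]

end Literature.MathematicalPhysics.QuantumLattice
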